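import Literature.MathematicalPhysics.QuantumLattice.HubbardShiftedSliceGram
import HarnessLib

/-!
# The Gram constant of a shifted slice with the TRIVIAL momentum count: `κ² ≲ Λ′/Λ` (large and ultraviolet slices)

Topic `MathematicalPhysics/QuantumLattice`; companion of `HubbardShiftedSliceGram.lean`.  There the phase-space count of the
shell `Λ²/4 < ω² + ξ² < Λ′²` uses the sharp shell count `card_torusShell_le`, valid for thin shells `Λ′ ≤ d₀/2` around a
level at distance `d₀` from the van Hove level and the band edges.  For the finitely many THICK infrared slices and for the
ULTRAVIOLET slices `|iω - ξ| ≳ 1` (integrated first, upward in the Matsubara frequency with a fixed ratio `γ > e`, up to the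
cut-off `M`; cell gate-hubbard-kl, R0-SCOPE-2 §5.2) the trivial momentum count `L²` suffices: the Gram constant of the slice
is then `≲ Λ′/Λ = γ`, uniformly in `β, L, M` (Benfatto–Giuliani–Mastropietro 2006, (2.80) and App. A1: the ultraviolet
integration has `O(1)` constants per scale).

* `card_freqSupport_le` — `#{(ω, k⃗) : |ω| ≤ Λ′} ≤ (Λ′β/π + 3) L²`;
* **`norm_sq_sectorGramF_shiftedSlice_le_trivial`** — for `‖F_ω(k)‖ ≤ 1`, `0 < β`, `0 < Λ ≤ Λ′`, `|θ| ≤ π/(4β)`: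
  `‖F_Y‖² ≤ (βL²)^{-2} · (Λ′β/π + 3) L² · (8/3)βL²/Λ = (8/3)(Λ′β/π + 3)/(βΛ)`.

Everything is proved; no definitions, no named facts.

## Sources

G. Benfatto, A. Giuliani, V. Mastropietro, Ann. Henri Poincaré 7 (2006) 809–898, §2.8 (2.80), App. A1 (A1.2)–(A1.3)
(`BenfattoGiulianiMastropietro2006`).
-/

noncomputable section

namespace Literature.MathematicalPhysics.QuantumLattice

open Literature.Probability.LatticeModels GrassmannAlgebra Finset

variable {L M : ℕ}

/-- **The frequency count with the trivial momentum count**: `#{(ω, k⃗) : |ω| ≤ Λ′} ≤ (Λ′β/π + 3)·L²` (`0 < β`, `0 ≤ Λ′`).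
[cite: BenfattoGiulianiMastropietro2006, App. A1 (A1.2)] -/
theorem card_freqSupport_le [NeZero L] {β : ℝ} (hβ : 0 < β) {Λ' : ℝ} (hΛ' : 0 ≤ Λ') :
    ((((univ : Finset (FreqMomentum L M)).filter fun k => |matsubaraFreq β M k.1| ≤ Λ' ∧ True).card : ℕ) : ℝ) ≤
      (Λ' * β / Real.pi + 3) * (L : ℝ) ^ 2 := by
  classical
  rw [card_filter_freqMomentum_eq (fun i : MatsubaraIdx M => |matsubaraFreq β M i| ≤ Λ') (fun _ : TorusSite 2 L => True),
    Nat.cast_mul]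
  refine mul_le_mul (card_filter_matsubaraFreq_le hβ hΛ' _ fun i hi => (mem_filter.1 hi).2) ?_ (Nat.cast_nonneg _)
    (by positivity)
  calc ((((univ : Finset (TorusSite 2 L)).filter fun _ => True).card : ℕ) : ℝ) ≤ (Fintype.card (TorusSite 2 L) : ℝ) := by
        exact_mod_cast card_le_univ _
    _ = (L : ℝ) ^ 2 := by
        rw [Fintype.card_pi, Fin.prod_const, ZMod.card]
        push_cast
        ring

/-- **The Gram constant of the shifted slice with the trivial momentum count** (thick infrared slices and the ultraviolet
slices): for multipliers `‖F_ω(k)‖ ≤ 1`, `0 < β`, `0 < Λ ≤ Λ′` and `|θ| ≤ π/(4β)`,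
`‖F_Y‖² ≤ (βL²)^{-2} · (Λ′β/π + 3)L² · (8/3)βL²/Λ ≍ Λ′/Λ`, uniformly in `β, L, M` and the level `μ`.
[cite: BenfattoGiulianiMastropietro2006, §2.8 (2.80)] -/
theorem norm_sq_sectorGramF_shiftedSlice_le_trivial [NeZero L] {N : ℕ} {β : ℝ} (hβ : 0 < β) (μ : ℝ) {θ : ℝ}
    (hθ : |θ| ≤ Real.pi / (4 * β)) {Λ Λ' : ℝ} (hΛ : 0 < Λ) (hΛΛ' : Λ ≤ Λ')
    (F : Fin N → FreqMomentum L M → ℂ) (hF : ∀ ω k, ‖F ω k‖ ≤ 1) (Y : SpaceTimeIdx L M × SectorLeg N) :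
    ‖sectorGramF L M β F (fun ks => ((hubbardCutoffWeight L M β μ Λ ks.1 : ℂ) - (hubbardCutoffWeight L M β μ Λ' ks.1 : ℂ)) *
        shiftedFreeSymbol L M β μ θ ks) Y‖ ^ 2 ≤
      ‖((1 / (β * (L : ℝ) ^ 2) : ℝ) : ℂ)‖ ^ 2 * (((Λ' * β / Real.pi + 3) * (L : ℝ) ^ 2) * (8 / 3 * (β * (L : ℝ) ^ 2) / Λ)) := by
  classical
  have hΛ' : 0 < Λ' := hΛ.trans_le hΛΛ'
  set T : Finset (FreqMomentum L M) := (univ : Finset (FreqMomentum L M)).filter fun k =>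
    |matsubaraFreq β M k.1| ≤ Λ' ∧ True with hT
  have h := norm_sq_sectorGramF_le (L := L) (M := M) β F
    (fun ks => ((hubbardCutoffWeight L M β μ Λ ks.1 : ℂ) - (hubbardCutoffWeight L M β μ Λ' ks.1 : ℂ)) *
      shiftedFreeSymbol L M β μ θ ks) Y (S := 8 / 3 * (β * (L : ℝ) ^ 2) / Λ) (fun k => ?_) T (fun k _ hp => ?_)
  · refine h.trans (mul_le_mul_of_nonneg_left ?_ (by positivity))
    exact mul_le_mul_of_nonneg_right (card_freqSupport_le hβ hΛ'.le) (by positivity)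
  · have h1 : ‖F Y.2.1.1 k‖ ^ 2 ≤ 1 := by
      have := hF Y.2.1.1 k
      nlinarith [norm_nonneg (F Y.2.1.1 k)]
    calc ‖F Y.2.1.1 k‖ ^ 2 * ‖((hubbardCutoffWeight L M β μ Λ (k, Y.2.1.2).1 : ℂ) -
            (hubbardCutoffWeight L M β μ Λ' (k, Y.2.1.2).1 : ℂ)) * shiftedFreeSymbol L M β μ θ (k, Y.2.1.2)‖
        ≤ 1 * (8 / 3 * (β * (L : ℝ) ^ 2) / Λ) :=
          mul_le_mul h1 (norm_sliceSymbol_le hβ μ hθ hΛ hΛΛ' (k, Y.2.1.2)) (norm_nonneg _) zero_le_one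
      _ = 8 / 3 * (β * (L : ℝ) ^ 2) / Λ := one_mul _
  · have hw : hubbardCutoffWeight L M β μ Λ k - hubbardCutoffWeight L M β μ Λ' k ≠ 0 := by
      intro h0
      apply hp
      have : ((hubbardCutoffWeight L M β μ Λ k : ℂ) - (hubbardCutoffWeight L M β μ Λ' k : ℂ)) = 0 := by exact_mod_cast h0
      simp only [this, zero_mul]
    obtain ⟨-, hhi⟩ := support_sliceWeight hΛ hΛΛ' k hw
    rw [hT, mem_filter]
    refine ⟨mem_univ _, ?_, trivial⟩
    have : matsubaraFreq β M k.1 ^ 2 ≤ Λ' ^ 2 := by nlinarith [sq_nonneg (nambuXi L μ k.2)]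
    exact abs_le_of_sq_le_sq' this hΛ'.le |>.elim (fun h1 h2 => abs_le.2 ⟨h1, h2⟩)

end Literature.MathematicalPhysics.QuantumLattice

end
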